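import Summits.QuantumFields.BalabanUV.Beta.D1BFx.CombStraightPinRestRowMass
import Summits.QuantumFields.BalabanUV.Beta.CombTablesAn1

/-!
# `BalabanUV.Beta.D1BFx.CombStraightPinRestRowRecord` — road «BF-x» for binder row D1, junction (J1), direction RE-TABLE (R-D1-g55-1), PART 24 HEAD row (rest):
# **THE RECORD BRIDGE — the (rest) pair of «COMB-REST-ROW-MASS» AT an2's COMB RECORD `combTablesAn1S2`: `M₂⁰ := M2Of 3 n (combTablesAn1S2 n hn cΛ).mixFF 0` IS node 12b's
# `mixFFAt ρ_c n` (weight `wM2 3 n 0 = 1`, field `rfl`), so `restRow_comb_head` holds VERBATIM at the record's mixed slot** — the comb twin of g63's `StraightPinRestRowMass.M2_record_eq ∕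
# hPs_record ∕ hPB_record ∕ restRow_head`.

HONEST DEPENDENCY (cell records, verbatim): «continuum YM on T⁴ ⇐ BetaPertH ∧ nine spine estimates (0/9 proved); BetaPertH ⇐ (D1) ∧ (D4) ∧
CAP+tail; G-an2-4 gates asym, D1 and NE2/3/4.»  HONEST FRAMING (cell contract, verbatim): «discharging `BetaPertH` makes Bałaban's UV stability
UNCONDITIONAL — a real constructive-QFT result; it is NOT the continuum limit and NOT the Clay problem.»  THIS MODULE DISCHARGES NOTHING of the
wall: [folklore] one `rfl`-level identity (an2 g55's `CombTablesAn1.combTablesAn1S2_mixFF`, lit `BalabanStepW2.M2Of ∕ wM2`) and three rewrites of this lineage's `CombStraightPinRestRowMass`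
letters under it.  No definition, no `def … : Prop`, nothing cited, 0 sorry.  An INTERMEDIATE per-word letter BELOW the OWNER's comb pin (RETABLE-SPEC-g28 — not typed yet): the word
here is `½·tadpole G₀ (mixOfK K₀ n M₂⁰ a 0 e z + mixOfK K₀ n M₂⁰ e z a 0)`, which the OWNER's table-generic pin identity `ChartDefectTwoPinsRest.tadpole_rest_record_eq` produces from ANY
HEAD literal whose `M₂` slot is `M₂⁰`; NOT the HEAD, NOT a binder; asserts NO n-law of `mixAbs` (d1-leaf-04's `MixedTableMass`), `CΓ`, `CΦ`; 0∕4 row-D1 binders (hW ∕ hR-sockets ∕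
hSX-socket ∕ D1Tel ∕ D1Rep); (J1) ONE OPEN ROW; (K) NOT closed; NOT D1, NEVER «G-an2-4 closed», NOT `BetaPertH`, NOT continuum, NOT Clay.

ABSOLUTE RULE (cell charter, verbatim): «No internally-minted statement may enter as a cited fact. Every hypothesis is either kernel-proved in
this package or a verbatim quotation of a PUBLISHED theorem with page reference. The manuscript(s) under audit are NOT citable for their own
disputed steps — they are the thing under adjudication; programme-internal (2001/route/tribunal) claims are never citable.»

CONTENT (`d = 3`, `[NeZero n]`, `hn : Odd n` — the record's standing parity binder, `cΛ : ℝ` — idle in the mixed slot).  **`M2_comb_record_eq`** (`M2Of 3 n (combTablesAn1S2 n hn cΛ).mixFF 0 κ u ρ w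
= mixFFAt (ctr 4 n) n κ u ρ w`), **`hPs_comb_record`**, **`hPB_comb_record`** (the `hPs ∕ hPB` sockets of g62 `StraightPinRestRow.restRow_K₀_of_blockSlotTotal` at the record, `T j i := if j ∧ i
then mixAbs (ctr 4 n) n·e^{4θ} else 0`), **`restRow_comb_record_head`** (`CombStraightPinRestRowMass.restRow_comb_head`'s statement with `mixFFAt (ctr 4 n) n ↦ M2Of 3 n (combTablesAn1S2 n hn cΛ).mixFF 0`,
right-hand side unchanged).
Unit `b2b-balaban-gan24-formalise-leaf-05` (gen 65), road «BF-x» supplier, (rest)-row lineage; INTENT-4 «COMB-REST-ROW-RECORD» (journal).  Not in print; our bookkeeping.  No existing file touched.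
-/

noncomputable section

open Finset
open scoped BigOperators
open Literature.MathematicalPhysics.QuantumFieldTheory.Balaban1983to89
open Literature.MathematicalPhysics.QuantumFieldTheory.Balaban1983to89.Beta
open B12Sec2to5 (l1)
open DecimatedMomentSummable (AbsMoment₂)
open B4ContourShift (supNorm)
open B5Hk163Strip (kappa163)
open B5Hk163Decay (MG163)
open B4TorusKernel (periodConst)
open ExpKernelCalculus (Site MKer Zl tadpole)
open AffineAveraging (box toSite)
open AveragingContoursRooted (ctr ctrOff ctrOff_mem_box)
open AveragingMixedJetTables (mixFFAt mixAbs)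
open KernelSpecInstance (wΦ)
open OneStepResolventKernel (Fib)
open OneStepKernelFamily (KInvStep)
open SecondOrderResponse (mixOfK)
open BalabanStepW2 (M2Of wM2)
open Summit.QuantumFields.BalabanUV.Beta.D1BFx.PackedKernelSplit (blk)
open Summit.QuantumFields.BalabanUV.Beta.CombTablesAn1 (combTablesAn1S2 combTablesAn1S2_mixFF)
open KKTFluctuationKernel (Gam)
open Summit.QuantumFields.BalabanUV.Beta.AxialDressingRooted (coDressKBmAt)
open Summit.QuantumFields.BalabanUV.Beta.D1BFx.CombStraightPinRestRowMass (hPs_comb hPB_comb restRow_comb_head)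

namespace Summit.QuantumFields.BalabanUV.Beta.D1BFx.CombStraightPinRestRowRecord

variable (n : ℕ) [NeZero n] (hn : Odd n)

omit [NeZero n] in
/-- [folklore] **THE COMB RECORD's MIXED TABLE AT STEP `0` IS node 12b's PACKED TABLE AT THE CENTRED ROOT**: `M2Of 3 n (combTablesAn1S2 n hn cΛ).mixFF 0 κ u ρ w = mixFFAt (ctr 4 n) n κ u ρ w`
(weight `wM2 3 n 0 = 1`; an2's field lemma `combTablesAn1S2_mixFF` is `rfl`) — the comb twin of g63 `StraightPinRestRowMass.M2_record_eq`. -/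
theorem M2_comb_record_eq (cΛ : ℝ) (κ : Fin (3 + 1)) (u : Fin (3 + 1) → ℤ) (ρ : Fin (3 + 1)) (w : Fin (3 + 1) → ℤ) :
    M2Of 3 n (combTablesAn1S2 n hn cΛ).mixFF 0 κ u ρ w = mixFFAt (ctr 4 n) n κ u ρ w := by
  show wM2 3 n 0 • (combTablesAn1S2 n hn cΛ).mixFF κ u ρ w = _
  rw [show wM2 3 n 0 = 1 by simp [wM2], one_smul, combTablesAn1S2_mixFF]

omit [NeZero n] in
/-- [folklore] The record's step-`0` mixed table as a function: `M2Of 3 n (combTablesAn1S2 n hn cΛ).mixFF 0 = mixFFAt (ctr 4 n) n`. -/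
theorem M2_comb_record_funext (cΛ : ℝ) : M2Of 3 n (combTablesAn1S2 n hn cΛ).mixFF 0 = mixFFAt (ctr 4 n) n := by
  funext κ u ρ w
  exact M2_comb_record_eq n hn cΛ κ u ρ w

/-- [folklore] **`hPs` AT THE COMB RECORD**: every block's fibre mass of the record's step-`0` mixed table is summable in the site pair. -/
theorem hPs_comb_record (cΛ : ℝ) :
    ∀ (κ : Fin (3 + 1)) (u : Fin (3 + 1) → ℤ) (ρ' : Fin (3 + 1)) (w : Fin (3 + 1) → ℤ) (j i : Bool),
      Summable fun p : Site 4 × Site 4 => ∑ g, ∑ f, |blk (M2Of 3 n (combTablesAn1S2 n hn cΛ).mixFF 0 κ u ρ' w) j i p.1 p.2 g f| := by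
  rw [M2_comb_record_funext n hn cΛ]
  exact hPs_comb n

/-- [folklore] **`hPB` AT THE COMB RECORD, WITH THE TABLE's OWN TOTAL** (`0 ≤ θ`): `T j i := if j ∧ i then mixAbs (ctr 4 n) n·e^{4θ} else 0`. -/
theorem hPB_comb_record (cΛ : ℝ) {θ : ℝ} (hθ : 0 ≤ θ) :
    ∀ (κ ρ' : Fin (3 + 1)) (y₁ w : Fin (3 + 1) → ℤ) (j i : Bool), ∑ b ∈ box (3 + 1) n,
      (∑' p : Site 4 × Site 4, ∑ g, ∑ f, |blk (M2Of 3 n (combTablesAn1S2 n hn cΛ).mixFF 0 κ ((n : ℤ) • y₁ + toSite b) ρ' w) j i p.1 p.2 g f|)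
        ≤ (if j = true ∧ i = true then mixAbs (ctr 4 n) n * Real.exp (θ * ((3 : ℝ) + 1)) else 0) * Real.exp (-θ * l1 (w - y₁)) := by
  rw [M2_comb_record_funext n hn cΛ]
  exact hPB_comb n hθ

/-- [our objects + folklore] **«COMB-REST-ROW-RECORD» — THE (rest) PAIR AT an2's COMB RECORD AND AT THE HEAD's LEG `G₀`, ALL SOCKETS FED BY TERM** (modulo the (K)-wall's ff letter `hΓ`, the
multiplier envelope `hΦ`, `cΛ`, and a free coarse rate `0 < θ`): `CombStraightPinRestRowMass.restRow_comb_head` with `mixFFAt (ctr 4 n) n` READ AS the record's `M2Of 3 n (combTablesAn1S2 n hn cΛ).mixFF 0` —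
the comb twin of g63 `StraightPinRestRowMass.restRow_head`, right-hand side identical with `symMixAbs ↦ mixAbs`. -/
theorem restRow_comb_record_head {CΓ δΓ : ℝ} (hCΓ : 0 ≤ CΓ) (hδΓ : 0 ≤ δΓ)
    (hΓ : ∀ (κ : Fin (3 + 1)) (x : Site 4) (l : Fin (3 + 1)) (x' : Site 4),
      |Gam (N := n) κ x l x'| ≤ CΓ * Real.exp (-δΓ * l1 (x - x')))
    {CΦ κ₀ : ℝ} (hκ₀ : 0 < κ₀)
    (hΦ : ∀ (ρ ν : Fin (3 + 1)) (w : Fin (3 + 1) → ℤ),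
      |wΦ (N := n) ρ ν w| ≤ CΦ * ((n : ℝ) ^ 5)⁻¹ * ((n : ℝ) ^ 3)⁻¹ * Real.exp (-(κ₀ * supNorm w)))
    (cΛ : ℝ) {θ : ℝ} (hθ : 0 < θ) (μ ν : Fin (3 + 1)) :
    (∀ a e : Fin (3 + 1), AbsMoment₂ (fun z : Site 4 => (1 / 2 : ℝ) * tadpole (coDressKBmAt (ctr 4 n) n (KInvStep (d := 3) n 0))
        (mixOfK (KInvStep (d := 3) n 0) n (M2Of 3 n (combTablesAn1S2 n hn cΛ).mixFF 0) a 0 e z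
          + mixOfK (KInvStep (d := 3) n 0) n (M2Of 3 n (combTablesAn1S2 n hn cΛ).mixFF 0) e z a 0))) ∧
      |B12Beta.secondMoment (fun (a e : Fin (3 + 1)) (z : Site 4) => (1 / 2 : ℝ) * tadpole (coDressKBmAt (ctr 4 n) n (KInvStep (d := 3) n 0))
          (mixOfK (KInvStep (d := 3) n 0) n (M2Of 3 n (combTablesAn1S2 n hn cΛ).mixFF 0) a 0 e z
            + mixOfK (KInvStep (d := 3) n 0) n (M2Of 3 n (combTablesAn1S2 n hn cΛ).mixFF 0) e z a 0)) μ ν|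
        ≤ ((1 / 2 : ℝ) * (((1 + 4 * (((3 : ℝ) + 1) * n)) ^ 2
              * (CΓ + (((n : ℝ) ^ 5)⁻¹ * ((MG163 4 * periodConst (kappa163 4) 3) * Real.exp (kappa163 4 / 4)))
                  + (((n : ℝ) ^ 5)⁻¹ * ((MG163 4 * periodConst (kappa163 4) 3) * Real.exp (kappa163 4 / 4)))
                  + (CΦ * ((n : ℝ) ^ 5)⁻¹ * ((n : ℝ) ^ 3)⁻¹ * Real.exp κ₀)))
            * (2 * ((((n : ℝ) ^ 5)⁻¹ * (((n : ℝ) ^ 5)⁻¹ * ((n : ℝ) ^ 3)⁻¹))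
            * (16 * ((MG163 4 * periodConst (kappa163 4) 3) * Real.exp (kappa163 4 / 4)) * (CΦ * Real.exp κ₀)
                * Real.exp (min (kappa163 4 / 4) κ₀) * Real.exp (min (kappa163 4 / 4) κ₀)
                * Zl 4 (min (kappa163 4 / 4) κ₀ / 8) * Zl 4 (θ / 2)))
            * (mixAbs (ctr 4 n) n * Real.exp (θ * ((3 : ℝ) + 1))))))
          * ∑' x : Site 4, l1 x ^ 2 * Real.exp (-(min (min (kappa163 4 / 4) κ₀ / 8) (θ / 2)) * l1 x) := by
  rw [M2_comb_record_funext n hn cΛ]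
  exact restRow_comb_head n hCΓ hδΓ hΓ hκ₀ hΦ hθ μ ν

end Summit.QuantumFields.BalabanUV.Beta.D1BFx.CombStraightPinRestRowRecord

end
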